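import Summits.ResolutionOfSingularities.ResolutionOfSingularities.Theorems.PurelyInseparableDim4PhiLineStepLaws
import HarnessLib

/-!
# (K-Φ2) chain dictionary VI: the COORDINATE frame of `𝒪 = K[x]_{𝔪₀}` — Newton points from monomials, and «`α > 0` ⇒ every low monomial
# carries `u₁`»

Cell `res-dim4-pi` (D-0157 DOOR 2), Φ = β_h line of res-dim4-idea-1 (CARD I-1-8 (C2)/(d): «at KEEP steps nothing is re-adapted: with α > 0 the
u₂-axis is EMPTY»; memo §6.2 (P2): the only cross monomials `Z^B U₂` come from the lattice point `(0,2)`/`(0,1)`, absent when `α > 0`). After (K-Φ2) V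
(`pts_ringEquiv`) every linear frame is the COORDINATE frame `c₀ = (x₀/1, x₁/1, x₂/1, x₃/1)` of a polynomial read in frame coordinates (`y = x₀, x₁`;
`u₁ = x₂`, `u₂ = x₃`: the indices `u1 2 = 2`, `u2 2 = 3` of `PolygonInvariantsIndexed`). For the coordinate frame the expansion-free polygon
vocabulary meets honest coefficients; this file proves (DEF-FREE):

* §1 `weightedOrderIdeal_coordFrame_eq_map` (`F_ρ(c₀) = F_ρ(X)·𝒪`), `mem_weightedOrderIdeal_X_iff` (in `K[x]`: `P ∈ F_ρ(X) ⟺` every monomial of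
  `P` has weight `≥ ρ`), `originIdeal_pow_le_weightedOrderIdeal_X`, `mem_of_algebraMap_mem_map_of_pow_le` (an ideal containing a power of `𝔪₀` is
  contracted from `𝒪`: clearing a unit denominator modulo `𝔪₀^k`), hence **`mem_weightedOrderIdeal_X_of_algebraMap_mem`**;
* §2 **`isInitialTerm_coordFrame_of_coeff`** — a monomial of `P` of least `w`-weight is an initial unit term of `P/1` in the coordinate frame
  (witness: the lowest weighted homogeneous component, coefficients units of `𝒪`); `mem_pts_coordFrame_of_coeff`; `alphaS_coordFrame_le_of_coeff`;
* §3 **`apply_u1_pos_of_alphaS_pos`** — if `(P/1)` has `αs > 0` (and `pts ≠ ∅`), every monomial `m` of `P` with `ydeg m < μ` has `m(u₁) ≥ 1`: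
  «`α > 0` ⇒ the `u₂`-axis is empty» at the level of COEFFICIENTS — the hypothesis `killVars U (pderiv u₂ Φ) = 0` of (K-Φ3) VI for the
  tangent form `Φ = in_d P` (no monomial `Y^B U₂`, `|B| = d − 1`): `coeff_add_single_u2_eq_zero_of_alphaS_pos`.

[OURS · counted 0 · AI work weaker than expert review.] Nothing here proves K2(p), the β_h line, or resolution of singularities in dimension ≥ 4 /
characteristic p.

Sources: V. Cossart, U. Jannsen, S. Saito, LNM **2270** (2020), Def. 8.2 (Newton points from a presentation), Lemma 12.2 (2) [`CossartJannsenSaito2020`];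
V. Cossart, O. Piltant, J. Algebra 320 (2008), §4 p. 10 (the exponent set `E`) [`CossartPiltant2008`].
-/

set_option linter.dupNamespace false

noncomputable section

namespace Summit.ResolutionOfSingularities.ResolutionOfSingularities.Theorems.PIDim4

namespace PhiLine

open MvPolynomial Finset IsLocalRing
open Literature.AlgebraicGeometry.Resolution
open Literature.AlgebraicGeometry.Resolution.Hauser2010
open Literature.AlgebraicGeometry.Resolution.WeightedOrder

variable {K : Type} [Field K]

/-! ## §1 Weighted order ideals of the coordinate frame, in `K[x]` and in `𝒪` -/

/-- `F_ρ(c₀) = F_ρ(X)·𝒪` for the coordinate frame `c₀ = alg ∘ X`. [cite: CossartJannsenSaito2020, Def. 7.2 (1)] -/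
theorem weightedOrderIdeal_coordFrame_eq_map (w : Fin 4 → ℕ) (ρ : ℕ) :
    weightedOrderIdeal (fun i => algebraMap (MvPolynomial (Fin 4) K) (OriginLocalization K 4) (X i)) w ρ =
      (weightedOrderIdeal (X : Fin 4 → MvPolynomial (Fin 4) K) w ρ).map (algebraMap (MvPolynomial (Fin 4) K) (OriginLocalization K 4)) := by
  unfold weightedOrderIdeal
  rw [Ideal.map_span]
  congr 1
  ext x
  have hc : ∀ m : Fin 4 →₀ ℕ, cmonom (fun i => algebraMap (MvPolynomial (Fin 4) K) (OriginLocalization K 4) (X i)) m =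
      algebraMap (MvPolynomial (Fin 4) K) (OriginLocalization K 4) (cmonom X m) := by
    intro m
    unfold cmonom
    rw [Finsupp.prod, Finsupp.prod, map_prod]
    refine Finset.prod_congr rfl fun i _ => ?_
    rw [map_pow]
  constructor
  · rintro ⟨m, hm, rfl⟩; exact ⟨cmonom X m, ⟨m, hm, rfl⟩, by rw [hc m]⟩
  · rintro ⟨_, ⟨m, hm, rfl⟩, rfl⟩; exact ⟨m, hm, by rw [hc m]⟩

/-- `X^m = monomial m 1` as a `cmonom` of the variables. [folklore] -/
theorem cmonom_X_eq_monomial (m : Fin 4 →₀ ℕ) : cmonom (X : Fin 4 → MvPolynomial (Fin 4) K) m = monomial m 1 := by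
  unfold cmonom
  rw [monomial_eq, C_1, one_mul]

/-- **In `K[x]`, membership in `F_ρ(X)` is read off the support**: every monomial has weight `≥ ρ`. [cite: CossartJannsenSaito2020, Def. 7.2 (1)] -/
theorem mem_weightedOrderIdeal_X_iff (w : Fin 4 → ℕ) (ρ : ℕ) (P : MvPolynomial (Fin 4) K) :
    P ∈ weightedOrderIdeal (X : Fin 4 → MvPolynomial (Fin 4) K) w ρ ↔ ∀ m ∈ P.support, ρ ≤ Finsupp.weight w m := by
  classical
  rw [mem_weightedOrderIdeal_iff_exists_mvPolynomial]
  constructor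
  · rintro ⟨Q, hQ, hQP⟩ m hm
    -- `P = Σ_n (coeff n Q) · x^n`: every monomial of `P` is `x^{n + k}` with `wt n ≥ ρ`
    rw [← hQP, MvPolynomial.eval_eq] at hm
    obtain ⟨n, hn, hmn⟩ := Finset.mem_biUnion.mp (support_sum hm)
    have hprod : (∏ i ∈ n.support, (X i : MvPolynomial (Fin 4) K) ^ n i) = monomial n 1 := by
      rw [monomial_eq, C_1, one_mul, Finsupp.prod]
    rw [hprod, mem_support_iff, coeff_mul_monomial'] at hmn
    by_cases hnm : n ≤ m
    · obtain ⟨k, rfl⟩ := exists_add_of_le hnm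
      rw [map_add]
      exact le_add_right (hQ n hn)
    · rw [if_neg hnm] at hmn
      exact absurd rfl hmn
  · intro h
    refine ⟨MvPolynomial.map C P, fun m hm => h m (support_map_subset _ _ hm), ?_⟩
    rw [eval_map, eval₂_eta]

/-- `𝔪₀^ρ ⊆ F_ρ(X)` for positive weights. [cite: CossartJannsenSaito2020, Def. 7.2 (1)] -/
theorem originIdeal_pow_le_weightedOrderIdeal_X {w : Fin 4 → ℕ} (hw : ∀ i, 0 < w i) (ρ : ℕ) :
    Literature.AlgebraicGeometry.Resolution.originIdeal K 4 ^ ρ ≤ weightedOrderIdeal (X : Fin 4 → MvPolynomial (Fin 4) K) w ρ := by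
  have h1 : Literature.AlgebraicGeometry.Resolution.originIdeal K 4 ≤ weightedOrderIdeal (X : Fin 4 → MvPolynomial (Fin 4) K) w 1 := by
    rw [Literature.AlgebraicGeometry.Resolution.originIdeal_eq_span, Ideal.span_le]
    rintro _ ⟨i, rfl⟩
    exact weightedOrderIdeal_antitone X w (hw i) (apply_mem_weightedOrderIdeal X w i)
  calc Literature.AlgebraicGeometry.Resolution.originIdeal K 4 ^ ρ ≤ weightedOrderIdeal X w 1 ^ ρ := Ideal.pow_right_mono h1 ρ
    _ ≤ weightedOrderIdeal X w (ρ * 1) := weightedOrderIdeal_pow_le X w 1 ρ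
    _ = weightedOrderIdeal X w ρ := by rw [mul_one]

/-- **An ideal containing a power of `𝔪₀` is contracted from `𝒪`**: if `𝔪₀^k ⊆ I` and `P/1 ∈ I·𝒪` then `P ∈ I` (clear the denominator `t ∉ 𝔪₀`, a unit
modulo `𝔪₀^k`). [folklore] -/
theorem mem_of_algebraMap_mem_map_of_pow_le {I : Ideal (MvPolynomial (Fin 4) K)} {k : ℕ}
    (hI : Literature.AlgebraicGeometry.Resolution.originIdeal K 4 ^ k ≤ I) {P : MvPolynomial (Fin 4) K}
    (hP : algebraMap (MvPolynomial (Fin 4) K) (OriginLocalization K 4) P ∈ I.map (algebraMap (MvPolynomial (Fin 4) K) (OriginLocalization K 4))) :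
    P ∈ I := by
  obtain ⟨t, ht, htP⟩ := exists_unit_mul_mem_of_algebraMap_mem_map hP
  -- `t = t₀ + t₁`, `t₀ ∈ Kˣ`, `t₁ ∈ 𝔪₀`; `s := Σ_{i<k} t₀^{-(i+1)} (-t₁)^i` has `s t ≡ 1 mod 𝔪₀^k`
  rw [← originIdeal_loc_eq] at ht
  set t₀ : K := constantCoeff t with ht₀
  have ht₀ne : t₀ ≠ 0 := fun h0 => ht ((Literature.AlgebraicGeometry.Resolution.mem_originIdeal_iff K 4).mpr h0)
  set t₁ : MvPolynomial (Fin 4) K := t - C t₀ with ht₁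
  have ht₁mem : t₁ ∈ Literature.AlgebraicGeometry.Resolution.originIdeal K 4 := by
    rw [Literature.AlgebraicGeometry.Resolution.mem_originIdeal_iff, ht₁, map_sub, constantCoeff_C, sub_self]
  -- geometric series: (C t₀ + t₁) * s = C t₀^k' - (-t₁)^k  style identity
  have hgeom : (C t₀ - (-t₁)) * ∑ i ∈ Finset.range k, (C t₀) ^ i * (-t₁) ^ (k - 1 - i) = (C t₀) ^ k - (-t₁) ^ k :=
    (Commute.all (C t₀) (-t₁)).mul_geom_sum₂ k
  have htsplit : t = C t₀ - (-t₁) := by rw [ht₁]; ring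
  have hmem : (-t₁) ^ k ∈ I := hI (Ideal.pow_mem_pow ((Ideal.neg_mem_iff _).mpr ht₁mem) k)
  -- `P * C t₀^k = P * (t * s + (-t₁)^k)`
  have hunit : IsUnit (C (t₀ ^ k) : MvPolynomial (Fin 4) K) := (IsUnit.mk0 _ (pow_ne_zero k ht₀ne)).map C
  have key : C (t₀ ^ k) * P ∈ I := by
    have hCk : (C t₀ : MvPolynomial (Fin 4) K) ^ k = t * (∑ i ∈ Finset.range k, (C t₀) ^ i * (-t₁) ^ (k - 1 - i)) + (-t₁) ^ k := by
      rw [htsplit, hgeom]; ring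
    have : C (t₀ ^ k) * P = (t * P) * (∑ i ∈ Finset.range k, (C t₀) ^ i * (-t₁) ^ (k - 1 - i)) + (-t₁) ^ k * P := by
      rw [map_pow, hCk]; ring
    rw [this]
    exact Ideal.add_mem _ (Ideal.mul_mem_right _ _ htP) (Ideal.mul_mem_right _ _ hmem)
  exact (Submodule.smul_mem_iff_of_isUnit I hunit).mp (by simpa [smul_eq_mul] using key)

/-- **Contraction of the coordinate frame's weighted order ideals**: `P/1 ∈ F_ρ(c₀)` iff every monomial of `P` has weight `≥ ρ` (positive weights).
[cite: CossartJannsenSaito2020, Def. 7.2 (1)] -/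
theorem mem_weightedOrderIdeal_X_of_algebraMap_mem {w : Fin 4 → ℕ} (hw : ∀ i, 0 < w i) {ρ : ℕ} {P : MvPolynomial (Fin 4) K}
    (hP : algebraMap (MvPolynomial (Fin 4) K) (OriginLocalization K 4) P ∈
      weightedOrderIdeal (fun i => algebraMap (MvPolynomial (Fin 4) K) (OriginLocalization K 4) (X i)) w ρ) :
    ∀ m ∈ P.support, ρ ≤ Finsupp.weight w m := by
  rw [weightedOrderIdeal_coordFrame_eq_map] at hP
  exact (mem_weightedOrderIdeal_X_iff w ρ P).mp (mem_of_algebraMap_mem_map_of_pow_le (originIdeal_pow_le_weightedOrderIdeal_X hw ρ) hP)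

/-! ## §2 Newton points from monomials -/

/-- **A monomial of least `w`-weight is an initial unit term of `P/1` in the coordinate frame** (witness: the lowest weighted homogeneous component,
whose coefficients are units of `𝒪`). [cite: CossartJannsenSaito2020, Def. 8.2] -/
theorem isInitialTerm_coordFrame_of_coeff (w : Fin 4 → ℕ) {P : MvPolynomial (Fin 4) K} {e : Fin 4 →₀ ℕ} (he : coeff e P ≠ 0)
    (hmin : ∀ m ∈ P.support, Finsupp.weight w e ≤ Finsupp.weight w m) :
    IsInitialTerm (fun i => algebraMap (MvPolynomial (Fin 4) K) (OriginLocalization K 4) (X i)) w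
      (algebraMap (MvPolynomial (Fin 4) K) (OriginLocalization K 4) P) e := by
  classical
  set alg := algebraMap (MvPolynomial (Fin 4) K) (OriginLocalization K 4) with halg
  set Q := MvPolynomial.map (algebraMap K (OriginLocalization K 4)) P with hQ
  have hevalQ : ∀ R : MvPolynomial (Fin 4) K, eval (fun i => alg (X i)) (MvPolynomial.map (algebraMap K (OriginLocalization K 4)) R) = alg R := by
    intro R
    rw [eval_map, IsScalarTower.algebraMap_eq K (MvPolynomial (Fin 4) K) (OriginLocalization K 4), MvPolynomial.algebraMap_eq,
      show (fun i => alg (X i)) = (alg : MvPolynomial (Fin 4) K → OriginLocalization K 4) ∘ X from rfl, ← eval₂_comp_left,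
      MvPolynomial.eval₂_eta]
  refine ⟨weightedHomogeneousComponent w (Finsupp.weight w e) Q, weightedHomogeneousComponent_isWeightedHomogeneous _ _, ?_, ?_⟩
  · rw [coeff_weightedHomogeneousComponent, if_pos rfl, hQ, coeff_map]
    exact (IsUnit.mk0 _ he).map _
  · have h := eval_sub_component_mem (fun i => alg (X i)) w (n := Finsupp.weight w e) (F := Q)
      (fun m hm => hmin m (support_map_subset _ _ hm))
    rwa [map_sub, hevalQ] at h

/-- Hence such a monomial of `y`-degree `< μ` is a point of the polygon of `(P/1)` in the coordinate frame (positive weight).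
[cite: CossartJannsenSaito2020, Def. 8.2] -/
theorem mem_pts_coordFrame_of_coeff {w : Fin (2 + 2) → ℕ} (hw : ∀ i, 0 < w i) {P : MvPolynomial (Fin 4) K} {e : Fin (2 + 2) →₀ ℕ}
    (he : coeff e P ≠ 0) (hmin : ∀ m ∈ P.support, Finsupp.weight w e ≤ Finsupp.weight w m) {μ : ℕ} (hy : ydeg e < μ) :
    e ∈ pts (fun i : Fin (2 + 2) => algebraMap (MvPolynomial (Fin 4) K) (OriginLocalization K 4) (X i))
      (Ideal.span {algebraMap (MvPolynomial (Fin 4) K) (OriginLocalization K 4) P}) μ :=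
  ⟨⟨_, Ideal.subset_span rfl, w, hw, isInitialTerm_coordFrame_of_coeff w he hmin⟩, hy⟩

/-! ## §3 `α > 0` ⇒ every low monomial carries `u₁` -/

/-- The coordinate frame generates `𝔪`. [folklore] -/
theorem span_range_coordFrame_eq_maximalIdeal :
    Ideal.span (Set.range fun i : Fin (2 + 2) => algebraMap (MvPolynomial (Fin 4) K) (OriginLocalization K 4) (X i)) =
      maximalIdeal (OriginLocalization K 4) := by
  rw [maximalIdeal_originLocalization_eq_map]
  have h := congrArg (Ideal.map (algebraMap (MvPolynomial (Fin 4) K) (OriginLocalization K 4)))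
    (Literature.AlgebraicGeometry.Resolution.originIdeal_eq_span K 4)
  rw [Ideal.map_span, ← Set.range_comp] at h
  exact h.symm

/-- **`α > 0` ⇒ every monomial of `y`-degree `< μ` has positive `u₁`-exponent** (coordinate frame): the steep half-planes `N x₁ + x₂ ≥ N` hold on
the polygon for every `N` (`αs ≥ 1`, scaled), hence `P/1 ∈ F^{(N,…,LN,L)}_{Nμ}(c₀)`, contracted to `K[x]`: a monomial `m` with `ydeg m < μ` and
`m(u₁) = 0` would need `L·m(u₂) ≥ N(μ − ydeg m) ≥ N` for every `N`. [cite: CossartJannsenSaito2020, Lemma 12.2 (2)] -/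
theorem apply_u1_pos_of_alphaS_pos {P : MvPolynomial (Fin 4) K} {μ : ℕ}
    (hα : 0 < alphaS (fun i : Fin (2 + 2) => algebraMap (MvPolynomial (Fin 4) K) (OriginLocalization K 4) (X i))
      (Ideal.span {algebraMap (MvPolynomial (Fin 4) K) (OriginLocalization K 4) P}) μ)
    {m : Fin (2 + 2) →₀ ℕ} (hm : m ∈ P.support) (hy : ydeg m < μ) : 0 < m (u1 2) := by
  by_contra h0
  push Not at h0
  have hm0 : m (u1 2) = 0 := Nat.le_zero.mp h0
  set c₀ : Fin (2 + 2) → OriginLocalization K 4 := fun i => algebraMap (MvPolynomial (Fin 4) K) (OriginLocalization K 4) (X i) with hc₀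
  set N := μ.factorial * m (u2 2) + 1 with hN
  -- the half-plane `N x₁ + x₂ ≥ N` holds on `pts`
  have hS : ∀ e ∈ pts c₀ (Ideal.span {algebraMap (MvPolynomial (Fin 4) K) (OriginLocalization K 4) P}) μ, N ≤ N * spt₁ μ e + 1 * spt₂ μ e := by
    intro e he
    have h1 : 1 ≤ spt₁ μ e := le_trans hα (alphaS_le he)
    nlinarith
  have hgen : Ideal.span (Set.range c₀) = maximalIdeal (OriginLocalization K 4) := span_range_coordFrame_eq_maximalIdeal
  have hJ := (le_weightedOrderIdeal_levelWeight_iff c₀ hgen ringKrullDim_originLocalization_two_add_two _ (μ := μ) (by omega : 0 < N)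
    (by omega : 0 < N) Nat.one_pos).mpr hS
  have hPmem := hJ (Ideal.subset_span rfl)
  have hall := mem_weightedOrderIdeal_X_of_algebraMap_mem (levelWeight_pos (by omega : 0 < N) (by omega : 0 < N) Nat.one_pos) hPmem m hm
  rw [WeightedOrder.weight_levelWeight, hm0, mul_zero, zero_add] at hall
  -- `N ydeg + L m(u₂) ≥ N μ` with `ydeg < μ`: impossible by the choice of `N`
  have h1 : N * ydeg m + N ≤ N * μ := by rw [← Nat.mul_succ]; exact Nat.mul_le_mul_left N hy
  have h2 : μ.factorial * (1 * m (u2 2)) < N := by rw [one_mul]; omega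
  omega

/-- **No `Y^B U₂` monomials when `α > 0`** (the hypothesis `h1` of (K-Φ3) VI for `i = u₂`): a monomial `β + e_{u₂}` with `β` supported on the
`y`-letters and `u₂` (`β(u₁) = 0`, `ydeg β < μ`) has zero coefficient. [cite: CossartJannsenSaito2020, Lemma 12.2 (2)] -/
theorem coeff_add_single_u2_eq_zero_of_alphaS_pos {P : MvPolynomial (Fin 4) K} {μ : ℕ}
    (hα : 0 < alphaS (fun i : Fin (2 + 2) => algebraMap (MvPolynomial (Fin 4) K) (OriginLocalization K 4) (X i))
      (Ideal.span {algebraMap (MvPolynomial (Fin 4) K) (OriginLocalization K 4) P}) μ)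
    {β : Fin (2 + 2) →₀ ℕ} (hβ1 : β (u1 2) = 0) (hy : ydeg β < μ) :
    coeff (β + Finsupp.single (u2 2) 1) P = 0 := by
  by_contra hne
  have hm : β + Finsupp.single (u2 2) 1 ∈ P.support := mem_support_iff.mpr hne
  have hy' : ydeg (β + Finsupp.single (u2 2) 1) < μ := by
    have : ydeg (β + Finsupp.single (u2 2) 1) = ydeg β := by
      unfold ydeg
      refine Finset.sum_congr rfl fun i _ => ?_
      rw [Finsupp.add_apply, Finsupp.single_eq_of_ne (castAdd_ne_u2 i), add_zero]
    omega
  have h := apply_u1_pos_of_alphaS_pos hα hm hy'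
  rw [Finsupp.add_apply, hβ1, Finsupp.single_eq_of_ne u1_ne_u2, add_zero] at h
  exact lt_irrefl 0 h

end PhiLine

end Summit.ResolutionOfSingularities.ResolutionOfSingularities.Theorems.PIDim4

end
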